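import Summits.Parity.GeneralizedHardyLittlewood.Statement
import HarnessLib
import HarnessLib.Audit

/-!
# The one-variable case of Green–Tao's generalised Hardy–Littlewood conjecture, as a NAMED OPEN STATEMENT

`Summit.Parity.GeneralizedHardyLittlewood.GeneralizedHardyLittlewoodDimOne` is the `d = 1` case of
`Literature.NumberTheory.Sieve.GeneralizedHardyLittlewood` (Green–Tao, Ann. of Math. 171 (2010), Conjecture 1.2):
the Dickson–Hardy–Littlewood prime `t`-tuples conjecture with von Mangoldt weights, UNIFORM over all
non-degenerate systems `Ψ = (a₁ n + b₁, …, a_t n + b_t)` of size `‖Ψ‖_N ≤ L` (so `Σ|aᵢ| ≤ L`, `|bᵢ| ≤ L·N`) and all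
convex `K ⊆ [−N, N]`:
`Σ_{n ∈ K ∩ ℤ} Πᵢ Λ(aᵢ n + bᵢ) = β_∞ Π_p β_p + o_{t,L}(N)`.

Why a named constant (definition item `defn-GeneralizedHardyLittlewoodDimOne`, filed 2026-08-15 `--for stmt-Parity-0819`,
and the DEFINITION REQUESTS paragraph of `Summits/Parity/GeneralizedHardyLittlewood/Theses/DicksonFibration.lean`):
this statement is the common TARGET / declared bridge premise of several routes of the sub-problem (route items
`Theses.DicksonFibration.DimOne` = stmt-Parity-0819, and the same text as `Theses.HyperbolicConstellations.DimOne`,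
`Theses.LeeYangFibres.DimOne`, `Theses.InverseSieveTuples.DimOne`). Its Lean text below is VERBATIM the text of those
items, so that each `DimOne ↔ GeneralizedHardyLittlewoodDimOne` is `Iff.rfl`; a conditional-bridge route can then name
`conditional_on := Summit.Parity.GeneralizedHardyLittlewood.GeneralizedHardyLittlewoodDimOne` (an existing constant outside
its own Theses file). By the human rule of 2026-08-15 (HarnessLib.Audit.Tags, `@[conjecture]`) open conjectures stated in
our theories live under `Summits/<S>/<Sub>/Theorems/` as obligation nodes — provable or refutable BY NAME, never a vendored
fact, never `_holds`-debt.

This file imports only the sub-problem `Statement` (hence only `Literature.*`), so that Theses files may import it.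
What it contains besides the definition: the PROVED specialisation
`generalizedHardyLittlewoodDimOne_of_generalizedHardyLittlewood : GeneralizedHardyLittlewood → GeneralizedHardyLittlewoodDimOne`
(`d := 1`; `N ^ 1 = N`). What is deliberately NOT here (it needs the Theses files and the Theorems cone; see
`Theorems/GeneralizedHardyLittlewoodDimOnePosition.lean`): the `Iff.rfl` identifications with the route items, the
converse `GeneralizedHardyLittlewoodDimOne → GeneralizedHardyLittlewood` (Green–Tao's fibration remark, arXiv:math/0606088
p. 5, PROVED in the tree as `Theorems.leeYangFibres_fibrationLemma`), the equivalence with the registered open core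
`Cruxes.DimOne.BirthSieve.TwoFlatFactorsCore` (admissible systems, `t ≥ 2`, rough-vs-rough form), and the hardness
certificates (`→ Literature.NumberTheory.Sieve.HardyLittlewoodTuples → TwinPrimeConjecture`; Landau–Siegel-hardness modulo
Matomäki–Merikoski).

STATUS: open for every `t ≥ 2` (it contains the twin-prime, Sophie Germain and — through the shift-uniformity —
binary Goldbach asymptotics); the `t = 1` slice is the prime number theorem in progressions modulo `a ≤ L`, uniform in
shifts `≤ L·N` (proved in the tree: `Cruxes.DimOne.BirthSieve.dimOne_one`). Green–Tao, §1 (arXiv p. 5): the case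
`d = 1, t > 1` "seems to be extremely difficult".

References: B. Green, T. Tao, *Linear equations in primes*, Ann. of Math. 171 (2010) 1753–1850, Def. 1.1, Conj. 1.2
[GreenTao2010]; L. E. Dickson, Messenger of Math. 33 (1904) 155–161 [Dickson1904]; G. H. Hardy, J. E. Littlewood,
Acta Math. 44 (1923), Conjecture B and Theorem X 1 [HardyLittlewood1923].
-/

namespace Summit.Parity.GeneralizedHardyLittlewood

/-- OPEN CONJECTURE — the `d = 1` case of Green–Tao's generalised Hardy–Littlewood conjecture (Conjecture 1.2 of
*Linear equations in primes* restricted to one variable; = Dickson–Hardy–Littlewood prime `t`-tuples with von Mangoldt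
weights, uniform in the shifts): for all positive integers `t, L` and every `ε > 0` there is `N₀` such that for all
`N ≥ N₀`, all systems `Ψ = (ψ₁, …, ψ_t)` of affine-linear forms `ψᵢ(n) = aᵢ n + bᵢ` on `ℤ` that are non-degenerate
(each `aᵢ ≠ 0`, no two forms rational multiples of each other) with `‖Ψ‖_N = Σᵢ |aᵢ| + Σᵢ |bᵢ / N| ≤ L`, and all convex
`K ⊆ [−N, N]`,
`|Σ_{n ∈ K ∩ ℤ} Πᵢ Λ(ψᵢ(n)) − β_∞(Ψ, K) · Π_p β_p(Ψ)| ≤ ε N`,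
with `β_∞ = vol(K ∩ Ψ⁻¹(ℝ₊ᵗ))` and `β_p = 𝔼_{n ∈ ℤ/p} Πᵢ Λ_{ℤ/p}(ψᵢ(n))` (vocabulary of
`Literature.NumberTheory.Sieve.LinearEquationsInPrimes`). VERBATIM the text of the route items `DimOne`
(stmt-Parity-0819 on route DicksonFibration; HyperbolicConstellations, LeeYangFibres, InverseSieveTuples), so that
`DimOne ↔ GeneralizedHardyLittlewoodDimOne` is `Iff.rfl`. STATUS: open for every `t ≥ 2` (twin primes `(n, n + 2)`,
Sophie Germain `(n, 2n + 1)`, Goldbach `(n, M − n)` with `M ≤ L N`); `t = 1` is the prime number theorem in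
progressions (proved in tree). Registered open statement: take it as a hypothesis `(h : GeneralizedHardyLittlewoodDimOne)`
or as a route's `conditional_on`; no `_holds` can be landed short of solving the problem, so it is not literature debt.
[cite: GreenTao2010, Conj. 1.2 (case d = 1) and §1 p. 5 of arXiv:math/0606088] [status: open] -/
@[conjecture] def GeneralizedHardyLittlewoodDimOne : Prop :=
  ∀ (t L : ℕ), 1 ≤ t → ∀ ε : ℝ, 0 < ε → ∃ N₀ : ℕ, ∀ N : ℕ, N₀ ≤ N → ∀ Ψ : Fin t → Literature.NumberTheory.Sieve.AffLinForm 1, Literature.NumberTheory.Sieve.IsNondegenerateSystem Ψ → Literature.NumberTheory.Sieve.affLinSize Ψ N ≤ L → ∀ K : Set (Fin 1 → ℝ), Convex ℝ K → K ⊆ Literature.NumberTheory.Sieve.realBox 1 N → |Literature.NumberTheory.Sieve.vonMangoldtSum Ψ K N - Literature.NumberTheory.Sieve.archFactor Ψ K * Literature.NumberTheory.Sieve.singularProduct Ψ| ≤ ε * (N : ℝ)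

/-- **The sub-problem Statement implies its one-variable case** (the specialisation `d := 1` of Green–Tao's
Conjecture 1.2; `ε N¹ = ε N`). The converse — Green–Tao's fibration remark "a `d`-parameter version … would follow
easily by holding `d − 1` of the variables fixed and summing in the remaining one" — is the proved tree theorem
`Summit.Parity.GeneralizedHardyLittlewood.Theorems.leeYangFibres_fibrationLemma` (recorded with this name in
`Theorems/GeneralizedHardyLittlewoodDimOnePosition.lean`). [cite: GreenTao2010, Conj. 1.2] -/
theorem generalizedHardyLittlewoodDimOne_of_generalizedHardyLittlewood :
    _root_.GeneralizedHardyLittlewood → GeneralizedHardyLittlewoodDimOne := by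
  intro h t L ht ε hε
  obtain ⟨N₀, hN₀⟩ := h 1 t L le_rfl ht ε hε
  refine ⟨N₀, fun N hN Ψ hΨ hL K hK hKN => ?_⟩
  simpa using hN₀ N hN Ψ hΨ hL K hK hKN

end Summit.Parity.GeneralizedHardyLittlewood
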